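/-
Copyright (c) 2026 the pub-hodgecm-mathlib formalisation cell (harness21).  Prover seat hodgecm-mathlib-LH4-p01 (g4), 2026-09-02: «TRACE-DUAL INDEX OF THE CONDUCTOR ORDER»
`[O_j^# : O_j] = q_v^{d+2j}` at a ramified CM place, any residue characteristic (LH4-plan (g5) WORD #29 (iv); wild base layer of the (D-RAM) column).
-/
import Literature.NumberTheory.Automorphic.RamifiedPlaceOrderAdditiveIndex   -- ★ p851167 LH4-p02 (g5): `relIndex_order_eq_pow` (ii), `relIndex_integer_traceDual_eq_pow` (iii), `relIndex_valued_le_eq_pow`, `exists_addSubgroup_*`; brings ★ MARS p851113, ★ σ-DEPTH, basis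
import Literature.NumberTheory.LocalFields.QuadraticLocalTracePlace          -- ★ p851136 LH4-p02 (g5): the trace bridge `valued_trace_le_one_iff_valued_add_galAdicCompletionMap`; brings ★ p851014 `RamifiedPlaceTraceDual`
import HarnessLib

/-!
# TRACE-DUAL INDEX OF THE CONDUCTOR ORDER at a ramified CM place: `[O_j^# : O_j] = q_v^{d+2j}`, any residue characteristic
# (Euler's lemma `O^# = g′(θ)⁻¹·O` for a monogenic order: Serre, *Local Fields* III §6 Cor. 2; Neukirch III §2; Cassels–Fröhlich VII §1.1)

Topic `NumberTheory/Automorphic`; namespace `Literature.NumberTheory.Automorphic.UnitaryGroup`.  THEOREMS ONLY (no definition, no instance, no notation, no named fact,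
no `sorry`; axioms ⊆ {propext, Classical.choice, Quot.sound}).  Cell `pub/hodgecm-mathlib` (D-0151), crux H413 = `stmt-HodgeConjecture-24833`; half A line LH4, WILD BASE
LAYER of the (D-RAM) column of row #183 «LT-DYADIC» — brick (B)(iv) of LH4-plan (g5) WORD #29 ∕ #31 (route R2), over ★ p851167 `RamifiedPlaceOrderAdditiveIndex` ((ii) ADDITIVE
MARS `[𝒪_w : O_j] = q^j`, (iii) `[𝒪_w^# : 𝒪_w] = q^d`, the ball index) and the trace bridge ★ p851136 `LocalFields/QuadraticLocalTracePlace` (★ p851014 `RamifiedPlaceTraceDual`).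
HONEST READER LABEL: banked base layer — consumers none live ((D-RAM) is a PRINT organ by ruling D74′; scope audit LH4-plan (g5) b4c7662647f1db69 «COVERED at v ∣ 2»);
unconditional local algebra, count-neutral; HC_CM is proved only modulo the 7 printed citations (2 remaining named inputs: hLiu418 = stmt-HodgeConjecture-24832, h413 =
stmt-HodgeConjecture-24833) until rung 0 closes.

SETTING (= ★ MARS ∕ ★ σ-DEPTH).  `L` CM, `w ∣ v` with `c • w = w`, `e(w|v) ≠ 1`; `E = L_w`, `F = L⁺_v`, `ι = toPlace v w`, `σ = σ_w`, `τ` a uniformiser of `E` with Eisenstein trace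
`τ + στ = ι u₀` (`|u₀| < 1`), `δ := τ − στ` (SKEW: `σδ = −δ`; `|δ| = |στ − τ| = D = exp(−d)`), `q_v = |𝓀(L⁺_v)| = N(v)`.  The conductor-`j` ORDER `O_j = 𝒪_v + ϖ_v^j𝒪_w` is read
σ-intrinsically as `{x : |x| ≤ 1, |σx − x| ≤ exp(−2j)·D}` (hypothesis-characterised `AddSubgroup`, ★ `exists_addSubgroup_order`), and its TRACE DUAL `O_j^#` as
`{y : ∀ x ∈ O_j, |Tr_{E∕F}(x·y)|_v ≤ 1}` — `Tr` = Mathlib's `Algebra.trace` for the packet `L⁺_v`-algebra structure on `L_w` read at `(w : SemiLocal.Place L⁺ L v)` (★ p851136 §4,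
★ p851161) — or equivalently (★ bridge `ι(Tr z) = z + σz`) in σ-letters `{y : ∀ x ∈ O_j, |x·y + σ(x·y)|_w ≤ 1}`; no `dualSubmodule`, no `Module 𝒪_v`, no `Basis` is used.

THE MATHEMATICS.  (§1) In the DUAL COORDINATES `δ·y = ι a + ι b·τ` one has `y + σy = ι b` and `(ι c·τ)·y + σ(…) = ι(c(a + b u₀))` (apply `σ`, which negates `δ`, and divide by
`δ`; `τ² − (στ)² = δ·(τ + στ)`), hence `Tr(x·y) = ι(p b + q c(a + b u₀))` for `x = ι p + ι q·ι c·τ`.  (§2) EULER'S LEMMA: pairing `y` integrally with `O_j = 𝒪_v ⊕ 𝒪_v·ϖ_v^jτ`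
means `|b| ≤ 1 ∧ |a| ≤ exp(j)` (`|u₀| < 1`), i.e. `ι(ϖ_v)^j·δ·y = ι(ϖ^j a) + ι(ϖ^j b)τ ∈ O_j`: **`O_j^# = (ϖ_v^j δ)⁻¹·O_j`** — `g′(θ) = 2θ − ϖ_v^j u₀ = ϖ_v^j δ` for the generator
`θ = ϖ_v^jτ`, `g = X² − ϖ_v^ju₀X − ϖ_v^{2j}v₀` [Serre1979 III §6 Cor. 2] (`forall_mem_order_valued_mul_add_galAdicCompletionMap_le_one_iff`, `mem_orderTraceDual_iff{,_of_trace}`).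
(§3) The scaling `y ↦ ϖ_v^jδ·y` is an additive automorphism carrying `O_j^# ↦ O_j` and `𝒪_w^# = δ⁻¹𝒪_w ↦ ϖ_v^j𝒪_w`, so `[O_j^# : 𝒪_w^#] = [O_j : ϖ_v^j𝒪_w]` (Mathlib
`AddSubgroup.relIndex_comap`), and `[O_j : ϖ_v^j𝒪_w]·[𝒪_w : O_j] = [𝒪_w : ϖ_v^j𝒪_w] = q^{2j}` gives **`[O_j^# : 𝒪_w^#] = q^j`** (`relIndex_integerTraceDual_orderTraceDual_eq_pow`).
(§4) The chain `O_j ≤ 𝒪_w ≤ 𝒪_w^# ≤ O_j^#` and `AddSubgroup.relIndex_mul_relIndex`: **`[O_j^# : O_j] = q^j · q^d · q^j = q^{d+2j}`** (HEAD `relIndex_order_orderTraceDual_eq_pow`, absolute-norm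
and σ-letter dresses, one existence package, and the `j = 0` sanity `[𝒪_w^# : 𝒪_w] = q^d`).  Equivalently `disc(O_j) = 𝔭_v^{d+2j}`: the Gram determinant of `(1, ϖ_v^jτ)` is
`ϖ_v^{2j}(u₀² + 4v₀)`, `|u₀² + 4v₀|_v = exp(−d)` (★ `RamifiedPlaceOrderDiscriminant.valued_trace_sq_add_four_mul`, cited not used).  A third description of `O_j^#`, in the
DUAL (Gram) COORDINATES `(Tr y, Tr(τy))`, is ★ p851190 `RamifiedPlaceTraceGram.forall_mem_order_imp_valued_add_le_one_iff` (LH4-p02 (g5), whose parallel census draft of (iv) ran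
the same chain through those coordinates; sibling, not imported here).

* §1 `mul_le_self_iff_le_one_withZero`, `sub_galAdicCompletionMap_self_ne_zero`, `valued_sub_galAdicCompletionMap_self`, `add_galAdicCompletionMap_eq_toPlace_of_sub_mul_eq`,
  `toPlace_mul_mul_add_galAdicCompletionMap_eq_of_sub_mul_eq`, `mul_add_galAdicCompletionMap_mul_eq_of_sub_mul_eq`.
* §2 **`forall_mem_order_valued_mul_add_galAdicCompletionMap_le_one_iff`** (EULER), `mem_orderTraceDual_iff`, `forall_mem_valued_trace_mul_le_one_iff` (trace ↔ σ letters),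
  `mem_orderTraceDual_iff_of_trace`, `exists_addSubgroup_traceDual{,_of_trace}`.
* §3 **`relIndex_integerTraceDual_orderTraceDual_eq_pow`** (`[O_j^# : 𝒪_w^#] = q^j`).
* §4 `relIndex_order_orderTraceDual_eq_absNorm_pow` (σ-letters), **`relIndex_order_orderTraceDual_eq_pow`** (HEAD, trace letters), `…_eq_absNorm_pow_of_trace`,
  `exists_addSubgroups_order_orderTraceDual_relIndex_eq_pow`.

## References
* [Serre1979] J.-P. Serre, *Local Fields*, GTM 67 (1979): Ch. III §6 Lemma 2 and Cor. 2 (`(A[x])^# = f′(x)⁻¹A[x]`), Ch. III §3 Prop. 7 (`𝔇⁻¹` as trace dual), Ch. II §1.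
* [NeukirchANT1999] J. Neukirch, *Algebraic Number Theory* (1999): Ch. I §12 (orders and conductors), Ch. III §2 (2.4) (different of a monogenic order), (2.9) (`N(𝔇) = disc`).
* [CasselsFrohlichANT1967] J. W. S. Cassels, A. Fröhlich (eds.), *Algebraic Number Theory* (1967): Ch. VII (Fröhlich, local fields) §1.1 (trace form, dual module), Ch. I §4.
-/

set_option autoImplicit false

noncomputable section

open NumberField IsDedekindDomain ValuativeRel
open Literature.NumberTheory.GaloisRepresentations (SemiLocal.Place)
open scoped ValuativeRel WithZero

namespace Literature.NumberTheory.Automorphic.UnitaryGroup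

variable (L : Type) [Field L] [NumberField L] [IsCMField L] (v : HeightOneSpectrum (𝓞 ↥(maximalRealSubfield L)))
  (w : PlacesOver L v) (hw : IsCMField.complexConj L • w.1 = w.1) (he : v.asIdeal.ramificationIdx' w.1.asIdeal ≠ 1)

/-! ## §1 The skew element `δ = τ − στ` and traces in the dual coordinates `δ·y = ι a + ι b·τ` -/

omit [IsCMField L] in
/-- In `ℤᵐ⁰`: `c·x ≤ c ↔ x ≤ 1` for `c ≠ 0`. [cite: Serre1979, Ch. II §1] -/
theorem mul_le_self_iff_le_one_withZero {c x : WithZero (Multiplicative ℤ)} (hc : c ≠ 0) : c * x ≤ c ↔ x ≤ 1 := by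
  constructor
  · intro h
    exact (mul_le_mul_iff_of_pos_right (zero_lt_iff.2 hc)).1 (by rwa [one_mul, mul_comm])
  · intro h
    have := (mul_le_mul_iff_of_pos_right (zero_lt_iff.2 hc)).2 h
    rwa [one_mul, mul_comm] at this

include he in
/-- `τ − στ ≠ 0` at a ramified place (★ `valued_galAdicCompletionMap_sub_self_ne_zero`). [cite: Serre1979, Ch. IV §1 Prop. 4] -/
theorem sub_galAdicCompletionMap_self_ne_zero {τ : w.1.adicCompletion L} (hτ : Valued.v τ = WithZero.exp (-1 : ℤ)) :
    τ - galAdicCompletionMap (L := L) (IsCMField.complexConj L) hw τ ≠ 0 := by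
  intro h
  apply valued_galAdicCompletionMap_sub_self_ne_zero L v w hw he hτ
  rw [← neg_sub, h, neg_zero, map_zero]

/-- `|τ − στ| = |στ − τ|`. [cite: Serre1979, Ch. IV §1] -/
theorem valued_sub_galAdicCompletionMap_self (τ : w.1.adicCompletion L) :
    Valued.v (τ - galAdicCompletionMap (L := L) (IsCMField.complexConj L) hw τ) = Valued.v (galAdicCompletionMap (L := L) (IsCMField.complexConj L) hw τ - τ) :=
  Valuation.map_sub_swap _ _ _

/-- **THE TRACE IN THE DUAL COORDINATES**: if `(τ − στ)·y = ι a + ι b·τ` then `y + σy = ι b` (apply `σ`, which negates `τ − στ` and fixes `ι`, and subtract).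
[cite: Serre1979, Ch. III §6 Lemma 2] -/
theorem add_galAdicCompletionMap_eq_toPlace_of_sub_mul_eq {τ y : w.1.adicCompletion L} (hδ : τ - galAdicCompletionMap (L := L) (IsCMField.complexConj L) hw τ ≠ 0)
    {a b : v.adicCompletion ↥(maximalRealSubfield L)}
    (h : (τ - galAdicCompletionMap (L := L) (IsCMField.complexConj L) hw τ) * y = toPlace v w a + toPlace v w b * τ) :
    y + galAdicCompletionMap (L := L) (IsCMField.complexConj L) hw y = toPlace v w b := by
  have hσ := congrArg (galAdicCompletionMap (L := L) (IsCMField.complexConj L) hw) h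
  rw [map_mul, galAdicCompletionMap_sub_galAdicCompletionMap_self L v w hw τ, galAdicCompletionMap_toPlace_add_toPlace_mul L v w hw τ a b] at hσ
  -- `δ·(y + σy) = ι b · δ`
  have key : (τ - galAdicCompletionMap (L := L) (IsCMField.complexConj L) hw τ) * (y + galAdicCompletionMap (L := L) (IsCMField.complexConj L) hw y) =
      (τ - galAdicCompletionMap (L := L) (IsCMField.complexConj L) hw τ) * toPlace v w b := by
    linear_combination h - hσ
  exact mul_left_cancel₀ hδ key

/-- **THE TWISTED TRACE IN THE DUAL COORDINATES**: if `τ + στ = ι u₀` and `(τ − στ)·y = ι a + ι b·τ` then for every `c ∈ L⁺_v`,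
`(ι c·τ)·y + σ((ι c·τ)·y) = ι (c·(a + b·u₀))` (`τ² − (στ)² = (τ − στ)(τ + στ)`). [cite: Serre1979, Ch. III §6 Lemma 2] -/
theorem toPlace_mul_mul_add_galAdicCompletionMap_eq_of_sub_mul_eq {τ y : w.1.adicCompletion L} {u₀ : v.adicCompletion ↥(maximalRealSubfield L)}
    (htr : τ + galAdicCompletionMap (L := L) (IsCMField.complexConj L) hw τ = toPlace v w u₀)
    (hδ : τ - galAdicCompletionMap (L := L) (IsCMField.complexConj L) hw τ ≠ 0)
    {a b : v.adicCompletion ↥(maximalRealSubfield L)}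
    (h : (τ - galAdicCompletionMap (L := L) (IsCMField.complexConj L) hw τ) * y = toPlace v w a + toPlace v w b * τ) (c : v.adicCompletion ↥(maximalRealSubfield L)) :
    toPlace v w c * τ * y + galAdicCompletionMap (L := L) (IsCMField.complexConj L) hw (toPlace v w c * τ * y) = toPlace v w (c * (a + b * u₀)) := by
  have hσ := congrArg (galAdicCompletionMap (L := L) (IsCMField.complexConj L) hw) h
  rw [map_mul, galAdicCompletionMap_sub_galAdicCompletionMap_self L v w hw τ, galAdicCompletionMap_toPlace_add_toPlace_mul L v w hw τ a b] at hσ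
  have hσι : galAdicCompletionMap (L := L) (IsCMField.complexConj L) hw (toPlace v w c) = toPlace v w c := galAdicCompletionMap_toPlace (IsCMField.complexConj L) w w hw c
  have key : (τ - galAdicCompletionMap (L := L) (IsCMField.complexConj L) hw τ) *
        (toPlace v w c * τ * y + galAdicCompletionMap (L := L) (IsCMField.complexConj L) hw (toPlace v w c * τ * y)) =
      (τ - galAdicCompletionMap (L := L) (IsCMField.complexConj L) hw τ) * toPlace v w (c * (a + b * u₀)) := by
    rw [map_mul, map_mul, hσι, map_mul, map_add, map_mul, ← htr]
    linear_combination (toPlace v w c * τ) * h - (toPlace v w c * galAdicCompletionMap (L := L) (IsCMField.complexConj L) hw τ) * hσ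
  exact mul_left_cancel₀ hδ key

/-- **THE TRACE AGAINST AN ELEMENT OF `ι L⁺_v ⊕ ι L⁺_v·ι c·τ`**: with the data of the previous two lemmas, for `x = ι p + ι q·(ι c·τ)`,
`x·y + σ(x·y) = ι (p·b + q·(c·(a + b·u₀)))` (`σ` fixes `ι p`, `ι q`). [cite: Serre1979, Ch. III §3, §6 Lemma 2] -/
theorem mul_add_galAdicCompletionMap_mul_eq_of_sub_mul_eq {τ y : w.1.adicCompletion L} {u₀ : v.adicCompletion ↥(maximalRealSubfield L)}
    (htr : τ + galAdicCompletionMap (L := L) (IsCMField.complexConj L) hw τ = toPlace v w u₀)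
    (hδ : τ - galAdicCompletionMap (L := L) (IsCMField.complexConj L) hw τ ≠ 0)
    {a b : v.adicCompletion ↥(maximalRealSubfield L)}
    (h : (τ - galAdicCompletionMap (L := L) (IsCMField.complexConj L) hw τ) * y = toPlace v w a + toPlace v w b * τ) (c p q : v.adicCompletion ↥(maximalRealSubfield L)) :
    (toPlace v w p + toPlace v w q * (toPlace v w c * τ)) * y +
        galAdicCompletionMap (L := L) (IsCMField.complexConj L) hw ((toPlace v w p + toPlace v w q * (toPlace v w c * τ)) * y) =
      toPlace v w (p * b + q * (c * (a + b * u₀))) := by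
  have h1 := add_galAdicCompletionMap_eq_toPlace_of_sub_mul_eq L v w hw hδ h
  have h2 := toPlace_mul_mul_add_galAdicCompletionMap_eq_of_sub_mul_eq L v w hw htr hδ h c
  have hσp : galAdicCompletionMap (L := L) (IsCMField.complexConj L) hw (toPlace v w p) = toPlace v w p := galAdicCompletionMap_toPlace (IsCMField.complexConj L) w w hw p
  have hσq : galAdicCompletionMap (L := L) (IsCMField.complexConj L) hw (toPlace v w q) = toPlace v w q := galAdicCompletionMap_toPlace (IsCMField.complexConj L) w w hw q
  rw [show (toPlace v w p + toPlace v w q * (toPlace v w c * τ)) * y = toPlace v w p * y + toPlace v w q * (toPlace v w c * τ * y) by ring,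
    map_add (galAdicCompletionMap (L := L) (IsCMField.complexConj L) hw), map_mul (galAdicCompletionMap (L := L) (IsCMField.complexConj L) hw) (toPlace v w p),
    map_mul (galAdicCompletionMap (L := L) (IsCMField.complexConj L) hw) (toPlace v w q), hσp, hσq, map_add (toPlace v w), map_mul (toPlace v w) p,
    map_mul (toPlace v w) q]
  linear_combination (toPlace v w p) * h1 + (toPlace v w q) * h2

/-! ## §2 EULER'S LEMMA for the conductor order: `O_j^# = (ϖ_v^j·(τ − στ))⁻¹ · O_j` -/

include he in
/-- **EULER'S LEMMA FOR THE CONDUCTOR-`j` ORDER** `O_j = 𝒪_v + ϖ_v^j 𝒪_w` (read σ-intrinsically as `{x : |x| ≤ 1, |σx − x| ≤ exp(−2j)·|στ − τ|}`, ★ MARS ∕ ★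
`valued_galAdicCompletionMap_sub_self_le_iff_mem_order`): for every `y ∈ L_w`,
**`(∀ x ∈ O_j, |x·y + σ(x·y)|_w ≤ 1) ↔ ι(ϖ_v)^j·(τ − στ)·y ∈ O_j`** — the trace dual of the monogenic order `𝒪_v[θ]`, `θ = ϖ_v^j τ`, is `g′(θ)⁻¹·𝒪_v[θ]` with
`g′(θ) = 2θ − ϖ_v^j u₀ = ϖ_v^j (τ − στ)`.  Proof in the dual coordinates `(τ − στ)·y = ι a + ι b·τ` (§1): pairing with `1` and `θ` gives `ι b` and `ι(ϖ^j(a + b u₀))`, so the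
left side says `|b| ≤ 1 ∧ |a| ≤ exp(j)` (`|u₀| < 1`), which is exactly `ι(ϖ^j a) + ι(ϖ^j b)·τ ∈ O_j`. [cite: Serre1979, Ch. III §6 Lemma 2 and Cor. 2] [cite: NeukirchANT1999, Ch. III §2 (2.4)] -/
theorem forall_mem_order_valued_mul_add_galAdicCompletionMap_le_one_iff {τ : w.1.adicCompletion L} (hτ : Valued.v τ = WithZero.exp (-1 : ℤ))
    {ϖF : v.adicCompletion ↥(maximalRealSubfield L)} (hϖF : Valued.v ϖF = WithZero.exp (-1 : ℤ)) (j : ℕ) (O : AddSubgroup (w.1.adicCompletion L))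
    (hO : ∀ x, x ∈ O ↔ Valued.v x ≤ 1 ∧
      Valued.v (galAdicCompletionMap (L := L) (IsCMField.complexConj L) hw x - x) ≤ WithZero.exp (-(2 * j : ℤ)) * Valued.v (galAdicCompletionMap (L := L) (IsCMField.complexConj L) hw τ - τ))
    (y : w.1.adicCompletion L) :
    (∀ x ∈ O, Valued.v (x * y + galAdicCompletionMap (L := L) (IsCMField.complexConj L) hw (x * y)) ≤ 1) ↔
      toPlace v w ϖF ^ j * (τ - galAdicCompletionMap (L := L) (IsCMField.complexConj L) hw τ) * y ∈ O := by
  -- data: Eisenstein trace coefficient, the skew element `δ`, dual coordinates of `y`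
  obtain ⟨u₀, v₀, htr, -, hu₀, -⟩ := exists_eisenstein_coeffs_of_ramified L v w hw he hτ
  have hδ := sub_galAdicCompletionMap_self_ne_zero L v w hw he hτ
  obtain ⟨a, b, hab⟩ := exists_eq_toPlace_add_toPlace_mul L v w hw he hτ ((τ - galAdicCompletionMap (L := L) (IsCMField.complexConj L) hw τ) * y)
  have hι2 : ∀ z : v.adicCompletion ↥(maximalRealSubfield L), Valued.v (toPlace v w z) = Valued.v z ^ 2 := valued_toPlace_eq_sq_of_ramified L v w hw he
  have hϖj : Valued.v (ϖF ^ j) = WithZero.exp (-(j : ℤ)) := by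
    rw [map_pow, hϖF, ← WithZero.exp_nsmul]; congr 1; simp only [nsmul_eq_mul, mul_neg, mul_one]
  -- the scaled element in coordinates
  have hscaled : toPlace v w ϖF ^ j * (τ - galAdicCompletionMap (L := L) (IsCMField.complexConj L) hw τ) * y = toPlace v w (ϖF ^ j * a) + toPlace v w (ϖF ^ j * b) * τ := by
    rw [mul_assoc, hab, map_mul, map_mul, map_pow]; ring
  have hjpos : (0 : WithZero (Multiplicative ℤ)) < WithZero.exp (j : ℤ) := zero_lt_iff.2 WithZero.coe_ne_zero
  have hjpos' : (0 : WithZero (Multiplicative ℤ)) < WithZero.exp (-(j : ℤ)) := zero_lt_iff.2 WithZero.coe_ne_zero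
  -- `|ϖ^j a| ≤ 1 ↔ |a| ≤ exp j` and `|ϖ^j b| ≤ exp(−j) ↔ |b| ≤ 1`
  have hA : Valued.v (ϖF ^ j * a) ≤ 1 ↔ Valued.v a ≤ WithZero.exp (j : ℤ) := by
    rw [map_mul, hϖj, mul_comm, WithZero.exp_neg, mul_inv_le_iff₀ hjpos, one_mul]
  have hB : Valued.v (ϖF ^ j * b) ≤ WithZero.exp (-(j : ℤ)) ↔ Valued.v b ≤ 1 := by
    rw [map_mul, hϖj, mul_le_iff_le_one_right hjpos']
  -- membership of the scaled element: `|a| ≤ exp j ∧ |b| ≤ 1`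
  have hmem : toPlace v w ϖF ^ j * (τ - galAdicCompletionMap (L := L) (IsCMField.complexConj L) hw τ) * y ∈ O ↔ Valued.v a ≤ WithZero.exp (j : ℤ) ∧ Valued.v b ≤ 1 := by
    rw [hO, hscaled, ← exp_neg_sq, valued_galAdicCompletionMap_sub_self_le_sq_mul_iff L v w hw he hτ,
      v_le_one_iff_mem_integer, toPlace_add_toPlace_mul_mem_integer_iff L v w hw he hτ, ← v_le_one_iff_mem_integer, ← v_le_one_iff_mem_integer, hA, hB]
    constructor
    · rintro ⟨⟨ha, -⟩, hb⟩; exact ⟨ha, hb⟩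
    · rintro ⟨ha, hb⟩
      refine ⟨⟨ha, ?_⟩, hb⟩
      rw [map_mul, hϖj]
      calc WithZero.exp (-(j : ℤ)) * Valued.v b ≤ 1 * 1 := by
            gcongr
            · rw [← WithZero.exp_zero, WithZero.exp_le_exp]; omega
        _ = 1 := one_mul 1
  rw [hmem]
  constructor
  · intro h
    -- pair with `1 ∈ O` and with `θ = ι ϖ^j · τ ∈ O`
    have h1O : (1 : w.1.adicCompletion L) ∈ O := by
      rw [hO, map_one, map_one, sub_self, map_zero]; exact ⟨le_rfl, zero_le⟩
    have hθO : toPlace v w (ϖF ^ j) * τ ∈ O := by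
      rw [hO]
      refine ⟨?_, ?_⟩
      · rw [map_mul, hι2, hϖj, hτ, exp_neg_sq, ← WithZero.exp_add, ← WithZero.exp_zero, WithZero.exp_le_exp]; omega
      · rw [map_mul, galAdicCompletionMap_toPlace (IsCMField.complexConj L) w w hw, ← mul_sub, map_mul, hι2, hϖj, exp_neg_sq]
    have hb : Valued.v b ≤ 1 := by
      have := h 1 h1O
      rw [one_mul, add_galAdicCompletionMap_eq_toPlace_of_sub_mul_eq L v w hw hδ hab, hι2, sq_le_one_iff_withZero] at this
      exact this
    refine ⟨hA.1 ?_, hb⟩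
    have hθ := h _ hθO
    rw [toPlace_mul_mul_add_galAdicCompletionMap_eq_of_sub_mul_eq L v w hw htr hδ hab (ϖF ^ j), hι2, sq_le_one_iff_withZero] at hθ
    -- `|ϖ^j (a + b u₀)| ≤ 1` and `|ϖ^j b u₀| ≤ 1` give `|ϖ^j a| ≤ 1`
    rw [show ϖF ^ j * a = ϖF ^ j * (a + b * u₀) - ϖF ^ j * b * u₀ by ring]
    refine (Valuation.map_sub _ _ _).trans (max_le hθ ?_)
    rw [map_mul, map_mul, hϖj]
    calc WithZero.exp (-(j : ℤ)) * Valued.v b * Valued.v u₀ ≤ 1 * 1 * 1 := by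
          gcongr
          rw [← WithZero.exp_zero, WithZero.exp_le_exp]; omega
      _ = 1 := by rw [one_mul, one_mul]
  · rintro ⟨ha, hb⟩ x hx
    obtain ⟨hx1, hxσ⟩ := (hO x).1 hx
    obtain ⟨p, q, hp, hq, hxpq⟩ := (valued_galAdicCompletionMap_sub_self_le_iff_mem_order L v w hw he hτ hϖF j hx1).1 hxσ
    have hx' : x = toPlace v w p + toPlace v w q * (toPlace v w (ϖF ^ j) * τ) := by rw [hxpq, map_mul]; ring
    rw [hx', mul_add_galAdicCompletionMap_mul_eq_of_sub_mul_eq L v w hw htr hδ hab (ϖF ^ j) p q, hι2, sq_le_one_iff_withZero]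
    have hau : Valued.v (a + b * u₀) ≤ WithZero.exp (j : ℤ) := by
      refine (Valuation.map_add _ _ _).trans (max_le ha ?_)
      rw [map_mul]
      calc Valued.v b * Valued.v u₀ ≤ 1 * 1 := by gcongr
        _ ≤ WithZero.exp (j : ℤ) := by rw [one_mul, ← WithZero.exp_zero, WithZero.exp_le_exp]; omega
    refine (Valuation.map_add _ _ _).trans (max_le ?_ ?_)
    · rw [map_mul]
      calc Valued.v p * Valued.v b ≤ 1 * 1 := by gcongr
        _ = 1 := one_mul 1
    · rw [map_mul, map_mul, hϖj]
      calc Valued.v q * (WithZero.exp (-(j : ℤ)) * Valued.v (a + b * u₀)) ≤ 1 * (WithZero.exp (-(j : ℤ)) * WithZero.exp (j : ℤ)) := by gcongr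
        _ = 1 := by rw [one_mul, ← WithZero.exp_add, neg_add_cancel, WithZero.exp_zero]

include he in
/-- **EULER, MEMBERSHIP FORM (σ-letters)**: if `O♯` is the trace dual of the conductor-`j` order `O` (`y ∈ O♯ ↔ ∀ x ∈ O, |x·y + σ(x·y)| ≤ 1`) then
`y ∈ O♯ ↔ ι(ϖ_v)^j·(τ − στ)·y ∈ O`, i.e. **`O_j^# = (ϖ_v^j(τ − στ))⁻¹ · O_j`**. [cite: Serre1979, Ch. III §6 Cor. 2] [cite: NeukirchANT1999, Ch. III §2 (2.4)] -/
theorem mem_orderTraceDual_iff {τ : w.1.adicCompletion L} (hτ : Valued.v τ = WithZero.exp (-1 : ℤ))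
    {ϖF : v.adicCompletion ↥(maximalRealSubfield L)} (hϖF : Valued.v ϖF = WithZero.exp (-1 : ℤ)) (j : ℕ) (O Od : AddSubgroup (w.1.adicCompletion L))
    (hO : ∀ x, x ∈ O ↔ Valued.v x ≤ 1 ∧
      Valued.v (galAdicCompletionMap (L := L) (IsCMField.complexConj L) hw x - x) ≤ WithZero.exp (-(2 * j : ℤ)) * Valued.v (galAdicCompletionMap (L := L) (IsCMField.complexConj L) hw τ - τ))
    (hOd : ∀ y, y ∈ Od ↔ ∀ x ∈ O, Valued.v (x * y + galAdicCompletionMap (L := L) (IsCMField.complexConj L) hw (x * y)) ≤ 1) (y : w.1.adicCompletion L) :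
    y ∈ Od ↔ toPlace v w ϖF ^ j * (τ - galAdicCompletionMap (L := L) (IsCMField.complexConj L) hw τ) * y ∈ O := by
  rw [hOd y, forall_mem_order_valued_mul_add_galAdicCompletionMap_le_one_iff L v w hw he hτ hϖF j O hO y]

/-- **THE TRACE LETTER ↔ THE σ-LETTER** for the dual of any subset: `(∀ x ∈ O, |Tr_{L_w∕L⁺_v}(x·y)|_v ≤ 1) ↔ (∀ x ∈ O, |x·y + σ(x·y)|_w ≤ 1)` (★ bridge
`valued_trace_le_one_iff_valued_add_galAdicCompletionMap`, the trace for the packet `L⁺_v`-algebra structure on `L_w` read at `(w : SemiLocal.Place L⁺ L v)`).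
[cite: CasselsFrohlichANT1967, Ch. VII §1.1] -/
theorem forall_mem_valued_trace_mul_le_one_iff (O : AddSubgroup (w.1.adicCompletion L)) (y : w.1.adicCompletion L) :
    (∀ x ∈ O, Valued.v (Algebra.trace (v.adicCompletion ↥(maximalRealSubfield L)) (((w : SemiLocal.Place ↥(maximalRealSubfield L) L v) : HeightOneSpectrum (𝓞 L)).adicCompletion L) (x * y)) ≤ 1) ↔
      ∀ x ∈ O, Valued.v (x * y + galAdicCompletionMap (L := L) (IsCMField.complexConj L) hw (x * y)) ≤ 1 :=
  forall₂_congr fun x _ => valued_trace_le_one_iff_valued_add_galAdicCompletionMap L v w hw (x * y)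

include he in
/-- **EULER, MEMBERSHIP FORM (trace letters)**: for `O♯ = {y : ∀ x ∈ O_j, |Tr(x·y)|_v ≤ 1}` (Mathlib's `Algebra.trace` for the packet instance, as in ★
`QuadraticLocalTracePlace` §4 ∕ ★ `RamifiedPlaceDifferentIdeal`), `y ∈ O♯ ↔ ι(ϖ_v)^j·(τ − στ)·y ∈ O_j`. [cite: Serre1979, Ch. III §6 Cor. 2] [cite: CasselsFrohlichANT1967, Ch. VII §1.1] -/
theorem mem_orderTraceDual_iff_of_trace {τ : w.1.adicCompletion L} (hτ : Valued.v τ = WithZero.exp (-1 : ℤ))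
    {ϖF : v.adicCompletion ↥(maximalRealSubfield L)} (hϖF : Valued.v ϖF = WithZero.exp (-1 : ℤ)) (j : ℕ) (O Od : AddSubgroup (w.1.adicCompletion L))
    (hO : ∀ x, x ∈ O ↔ Valued.v x ≤ 1 ∧
      Valued.v (galAdicCompletionMap (L := L) (IsCMField.complexConj L) hw x - x) ≤ WithZero.exp (-(2 * j : ℤ)) * Valued.v (galAdicCompletionMap (L := L) (IsCMField.complexConj L) hw τ - τ))
    (hOd : ∀ y, y ∈ Od ↔ ∀ x ∈ O, Valued.v (Algebra.trace (v.adicCompletion ↥(maximalRealSubfield L)) (((w : SemiLocal.Place ↥(maximalRealSubfield L) L v) : HeightOneSpectrum (𝓞 L)).adicCompletion L) (x * y)) ≤ 1) (y : w.1.adicCompletion L) :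
    y ∈ Od ↔ toPlace v w ϖF ^ j * (τ - galAdicCompletionMap (L := L) (IsCMField.complexConj L) hw τ) * y ∈ O := by
  rw [hOd y, forall_mem_valued_trace_mul_le_one_iff L v w hw O y, forall_mem_order_valued_mul_add_galAdicCompletionMap_le_one_iff L v w hw he hτ hϖF j O hO y]

/-- **THE TRACE DUAL OF AN ADDITIVE SUBGROUP IS AN ADDITIVE SUBGROUP** (σ-letters; existence form, no definition): `∃ O♯, y ∈ O♯ ↔ ∀ x ∈ O, |x·y + σ(x·y)| ≤ 1`
(ultrametric: `x(y + y′) + σ(…) = (xy + σ(xy)) + (xy′ + σ(xy′))`). [cite: Serre1979, Ch. III §3] -/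
theorem exists_addSubgroup_traceDual (O : AddSubgroup (w.1.adicCompletion L)) :
    ∃ Od : AddSubgroup (w.1.adicCompletion L), ∀ y, y ∈ Od ↔ ∀ x ∈ O, Valued.v (x * y + galAdicCompletionMap (L := L) (IsCMField.complexConj L) hw (x * y)) ≤ 1 := by
  refine ⟨{ carrier := setOf fun y : w.1.adicCompletion L => ∀ x ∈ O, Valued.v (x * y + galAdicCompletionMap (L := L) (IsCMField.complexConj L) hw (x * y)) ≤ 1
            add_mem' := fun {a b} ha hb x hx => ?_
            zero_mem' := fun x _ => by rw [mul_zero, map_zero, add_zero, map_zero]; exact zero_le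
            neg_mem' := fun {a} ha x hx => ?_ }, fun y => Iff.rfl⟩
  · rw [show x * (a + b) + galAdicCompletionMap (L := L) (IsCMField.complexConj L) hw (x * (a + b)) = (x * a + galAdicCompletionMap (L := L) (IsCMField.complexConj L) hw (x * a)) + (x * b + galAdicCompletionMap (L := L) (IsCMField.complexConj L) hw (x * b)) by rw [mul_add, map_add]; ring]
    exact (Valued.v.map_add _ _).trans (max_le (ha x hx) (hb x hx))
  · rw [show x * -a + galAdicCompletionMap (L := L) (IsCMField.complexConj L) hw (x * -a) = -(x * a + galAdicCompletionMap (L := L) (IsCMField.complexConj L) hw (x * a)) by rw [mul_neg, map_neg]; ring, Valuation.map_neg]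
    exact ha x hx

include hw in
/-- The same in TRACE letters: `∃ O♯, y ∈ O♯ ↔ ∀ x ∈ O, |Tr(x·y)|_v ≤ 1`. [cite: Serre1979, Ch. III §3] [cite: CasselsFrohlichANT1967, Ch. VII §1.1] -/
theorem exists_addSubgroup_traceDual_of_trace (O : AddSubgroup (w.1.adicCompletion L)) :
    ∃ Od : AddSubgroup (w.1.adicCompletion L), ∀ y, y ∈ Od ↔ ∀ x ∈ O, Valued.v (Algebra.trace (v.adicCompletion ↥(maximalRealSubfield L)) (((w : SemiLocal.Place ↥(maximalRealSubfield L) L v) : HeightOneSpectrum (𝓞 L)).adicCompletion L) (x * y)) ≤ 1 := by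
  obtain ⟨Od, hOd⟩ := exists_addSubgroup_traceDual L v w hw O
  exact ⟨Od, fun y => (hOd y).trans (forall_mem_valued_trace_mul_le_one_iff L v w hw O y).symm⟩

/-! ## §3 The third factor: `[O_j^# : 𝒪_w^#] = [O_j : ϖ_v^j 𝒪_w] = q_v^j` by the scaling `y ↦ ι(ϖ_v)^j (τ − στ)·y` -/

include he in
/-- **`[O_j^# : 𝒪_w^#] = q_v^j`.**  The additive automorphism `y ↦ c·y`, `c = ι(ϖ_v)^j·(τ − στ)`, carries `O_j^#` onto `O_j` (EULER, §2) and `𝒪_w^# = (τ − στ)⁻¹𝒪_w = {|y|·D ≤ 1}`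
(★ `RamifiedPlaceTraceDual` §3) onto the ball `ϖ_v^j 𝒪_w = {|z| ≤ exp(−2j)}`; relative indices are invariant (Mathlib `AddSubgroup.relIndex_comap`), and
`[O_j : ϖ_v^j𝒪_w] · [𝒪_w : O_j] = [𝒪_w : ϖ_v^j𝒪_w]`, i.e. `? · q^j = q^{2j}` (★ ADDITIVE MARS `relIndex_order_eq_pow`, ★ ball index `relIndex_valued_le_eq_pow`).
[cite: Serre1979, Ch. III §6 Cor. 2] [cite: NeukirchANT1999, Ch. I §12, Ch. III §2 (2.4)] -/
theorem relIndex_integerTraceDual_orderTraceDual_eq_pow {τ : w.1.adicCompletion L} (hτ : Valued.v τ = WithZero.exp (-1 : ℤ)) (j : ℕ) (O Λd Od : AddSubgroup (w.1.adicCompletion L))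
    (hO : ∀ x, x ∈ O ↔ Valued.v x ≤ 1 ∧
      Valued.v (galAdicCompletionMap (L := L) (IsCMField.complexConj L) hw x - x) ≤ WithZero.exp (-(2 * j : ℤ)) * Valued.v (galAdicCompletionMap (L := L) (IsCMField.complexConj L) hw τ - τ))
    (hΛd : ∀ y, y ∈ Λd ↔ Valued.v y * Valued.v (galAdicCompletionMap (L := L) (IsCMField.complexConj L) hw τ - τ) ≤ 1)
    (hOd : ∀ y, y ∈ Od ↔ ∀ x ∈ O, Valued.v (x * y + galAdicCompletionMap (L := L) (IsCMField.complexConj L) hw (x * y)) ≤ 1) :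
    Λd.relIndex Od = Nat.card (𝓞 ↥(maximalRealSubfield L) ⧸ v.asIdeal) ^ j := by
  -- a uniformiser of `L⁺_v`, the scaling element `c = ι(ϖ)^j · (τ − στ) ≠ 0` and the scaling map
  obtain ⟨π, hπ⟩ := v.valuation_exists_uniformizer ↥(maximalRealSubfield L)
  have hϖF : Valued.v (π : v.adicCompletion ↥(maximalRealSubfield L)) = WithZero.exp (-1 : ℤ) := by rw [HeightOneSpectrum.valuedAdicCompletion_eq_valuation', hπ]
  set ϖF : v.adicCompletion ↥(maximalRealSubfield L) := (π : v.adicCompletion ↥(maximalRealSubfield L)) with hϖFdef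
  have hδ := sub_galAdicCompletionMap_self_ne_zero L v w hw he hτ
  have hD := valued_galAdicCompletionMap_sub_self_ne_zero L v w hw he hτ
  have hιϖj : Valued.v (toPlace v w ϖF ^ j) = WithZero.exp (-(2 * j : ℤ)) := by
    rw [map_pow, valued_toPlace_eq_sq_of_ramified L v w hw he, hϖF, ← pow_mul, ← WithZero.exp_nsmul]; congr 1
    simp only [nsmul_eq_mul]; push_cast; ring
  set c : w.1.adicCompletion L := toPlace v w ϖF ^ j * (τ - galAdicCompletionMap (L := L) (IsCMField.complexConj L) hw τ) with hcdef
  have hc0 : c ≠ 0 := mul_ne_zero (fun h => by rw [h, map_zero] at hιϖj; exact WithZero.zero_ne_coe hιϖj) hδ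
  have hvc : Valued.v c = WithZero.exp (-(2 * j : ℤ)) * Valued.v (galAdicCompletionMap (L := L) (IsCMField.complexConj L) hw τ - τ) := by
    rw [hcdef, map_mul, hιϖj, valued_sub_galAdicCompletionMap_self L v w hw τ]
  let f : w.1.adicCompletion L →+ w.1.adicCompletion L := AddMonoidHom.mulLeft c
  have hf : ∀ y, f y = c * y := fun y => rfl
  have hfsurj : Function.Surjective f := fun z => ⟨c⁻¹ * z, by rw [hf, mul_inv_cancel_left₀ hc0]⟩
  -- the ball `P = ϖ_v^j 𝒪_w` and the unit ball `Λ = 𝒪_w`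
  obtain ⟨P, hP⟩ := exists_addSubgroup_valued_le L v w (WithZero.exp (-((0 : ℤ) + (2 * j : ℕ))))
  obtain ⟨Λ, hΛ⟩ := exists_addSubgroup_valued_le L v w (WithZero.exp (-(0 : ℤ)))
  have hΛ1 : ∀ x, x ∈ Λ ↔ Valued.v x ≤ 1 := fun x => by rw [hΛ x, neg_zero, WithZero.exp_zero]
  have hP' : ∀ z, z ∈ P ↔ Valued.v z ≤ WithZero.exp (-(2 * j : ℤ)) := fun z => by rw [hP z]; push_cast; rw [zero_add]
  -- transport: `Λ♯ = P.comap f`, `O♯ = O.comap f`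
  have hΛd' : Λd = P.comap f := by
    ext y
    rw [AddSubgroup.mem_comap, hP', hf, map_mul, hvc, hΛd y, mul_assoc,
      mul_le_self_iff_le_one_withZero (c := WithZero.exp (-(2 * j : ℤ))) WithZero.coe_ne_zero, mul_comm]
  have hOd' : Od = O.comap f := by
    ext y
    rw [AddSubgroup.mem_comap, hf, mem_orderTraceDual_iff L v w hw he hτ hϖF j O Od hO hOd y]
  rw [hΛd', hOd', AddSubgroup.relIndex_comap, AddSubgroup.map_comap_eq_self_of_surjective hfsurj]
  -- `P ≤ O ≤ Λ` and the two known indices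
  have hPO : P ≤ O := by
    intro z hz
    rw [hP'] at hz
    have hι0 : toPlace v w ϖF ^ j ≠ 0 := fun h => by rw [h, map_zero] at hιϖj; exact WithZero.zero_ne_coe hιϖj
    set z' := (toPlace v w ϖF ^ j)⁻¹ * z with hz'def
    have hzz' : z = toPlace v w ϖF ^ j * z' := by rw [hz'def, mul_inv_cancel_left₀ hι0]
    have hz'1 : Valued.v z' ≤ 1 := by
      have h := hz
      rw [hzz', map_mul, hιϖj] at h
      exact (mul_le_self_iff_le_one_withZero WithZero.coe_ne_zero).1 h
    rw [hO, hzz', map_mul, hιϖj]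
    refine ⟨?_, ?_⟩
    · calc WithZero.exp (-(2 * j : ℤ)) * Valued.v z' ≤ 1 * 1 := by
            gcongr
            rw [← WithZero.exp_zero, WithZero.exp_le_exp]; omega
        _ = 1 := one_mul 1
    · have hσι : galAdicCompletionMap (L := L) (IsCMField.complexConj L) hw (toPlace v w ϖF ^ j) = toPlace v w ϖF ^ j := by
        rw [map_pow, galAdicCompletionMap_toPlace (IsCMField.complexConj L) w w hw]
      rw [map_mul, hσι, ← mul_sub, map_mul, hιϖj]
      gcongr
      exact valued_galAdicCompletionMap_sub_self_le_of_mem_integer L v w hw he hτ hz'1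
  have hOΛ : O ≤ Λ := fun x hx => (hΛ1 x).2 ((hO x).1 hx).1
  have h1 := AddSubgroup.relIndex_mul_relIndex P O Λ hPO hOΛ
  rw [relIndex_order_eq_pow L v w hw he hτ j Λ O hΛ1 hO, relIndex_valued_le_eq_pow L v w hw he 0 (2 * j) P Λ hP hΛ, pow_mul', sq] at h1
  have hq : 0 < Nat.card (𝓞 ↥(maximalRealSubfield L) ⧸ v.asIdeal) := by
    rw [← natCard_residueField_valuativeRel_eq]
    haveI : Nonempty 𝓀[v.adicCompletion ↥(maximalRealSubfield L)] := ⟨0⟩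
    exact Nat.card_pos
  exact Nat.eq_of_mul_eq_mul_right (pow_pos hq j) h1

/-! ## §4 The trace-dual index of the conductor order: `[O_j^# : O_j] = q_v^{d+2j}` -/

include he in
/-- **`[O_j^# : O_j] = q_v^{d + 2j}` (σ-letters).**  For the conductor-`j` order `O = O_j = {|x| ≤ 1, |σx − x| ≤ exp(−2j)·|στ − τ|}` and its trace dual
`O♯ = {y : ∀ x ∈ O, |x·y + σ(x·y)| ≤ 1}`, with `|στ − τ| = exp(−d)`: `O.relIndex O♯ = N(v)^(d + 2j)`.  Chain `O ≤ 𝒪_w ≤ 𝒪_w^# ≤ O♯` and Mathlib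
`AddSubgroup.relIndex_mul_relIndex`: `[𝒪_w : O] = q^j` (★ ADDITIVE MARS `relIndex_order_eq_pow`), `[𝒪_w^# : 𝒪_w] = q^d` (★ `relIndex_integer_traceDual_eq_pow`),
`[O♯ : 𝒪_w^#] = q^j` (§3).  This is `|disc(O_j)|_v⁻¹ = |ϖ_v^{2j}(u₀² + 4v₀)|_v⁻¹` (★ `RamifiedPlaceOrderDiscriminant.valued_trace_sq_add_four_mul`: `|u₀² + 4v₀|_v = exp(−d)`).
[cite: Serre1979, Ch. III §6 Cor. 2, Ch. III §3 Prop. 7] [cite: NeukirchANT1999, Ch. I §12, Ch. III §2 (2.4)] -/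
theorem relIndex_order_orderTraceDual_eq_absNorm_pow {τ : w.1.adicCompletion L} (hτ : Valued.v τ = WithZero.exp (-1 : ℤ)) {d : ℕ}
    (hd : Valued.v (galAdicCompletionMap (L := L) (IsCMField.complexConj L) hw τ - τ) = WithZero.exp (-(d : ℤ))) (j : ℕ) (O Od : AddSubgroup (w.1.adicCompletion L))
    (hO : ∀ x, x ∈ O ↔ Valued.v x ≤ 1 ∧
      Valued.v (galAdicCompletionMap (L := L) (IsCMField.complexConj L) hw x - x) ≤ WithZero.exp (-(2 * j : ℤ)) * Valued.v (galAdicCompletionMap (L := L) (IsCMField.complexConj L) hw τ - τ))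
    (hOd : ∀ y, y ∈ Od ↔ ∀ x ∈ O, Valued.v (x * y + galAdicCompletionMap (L := L) (IsCMField.complexConj L) hw (x * y)) ≤ 1) :
    O.relIndex Od = Nat.card (𝓞 ↥(maximalRealSubfield L) ⧸ v.asIdeal) ^ (d + 2 * j) := by
  -- the two intermediate lattices `Λ = 𝒪_w`, `Λ♯ = 𝒪_w^# = {|y|·D ≤ 1}`
  obtain ⟨Λ, hΛ⟩ := exists_addSubgroup_valued_le L v w (WithZero.exp (-(0 : ℤ)))
  have hΛ1 : ∀ x, x ∈ Λ ↔ Valued.v x ≤ 1 := fun x => by rw [hΛ x, neg_zero, WithZero.exp_zero]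
  obtain ⟨Λd, hΛd⟩ := exists_addSubgroup_valued_mul_le L v w (Valued.v (galAdicCompletionMap (L := L) (IsCMField.complexConj L) hw τ - τ))
  have hD1 : Valued.v (galAdicCompletionMap (L := L) (IsCMField.complexConj L) hw τ - τ) ≤ 1 :=
    (valued_galAdicCompletionMap_sub_self_le_exp_neg_one L v w hw hτ).trans (by rw [← WithZero.exp_zero, WithZero.exp_le_exp]; omega)
  have hOΛ : O ≤ Λ := fun x hx => (hΛ1 x).2 ((hO x).1 hx).1
  have hΛΛd : Λ ≤ Λd := fun y hy => (hΛd y).2 (by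
    calc Valued.v y * Valued.v (galAdicCompletionMap (L := L) (IsCMField.complexConj L) hw τ - τ) ≤ 1 * 1 := by gcongr; exact (hΛ1 y).1 hy
      _ = 1 := one_mul 1)
  have hΛdOd : Λd ≤ Od := fun y hy => (hOd y).2 fun x hx =>
    (forall_valued_add_galAdicCompletionMap_mul_le_one_iff L v w hw he hτ y).2 ((hΛd y).1 hy) x ((hO x).1 hx).1
  have h1 := AddSubgroup.relIndex_mul_relIndex O Λ Λd hOΛ hΛΛd
  have h2 := AddSubgroup.relIndex_mul_relIndex O Λd Od (hOΛ.trans hΛΛd) hΛdOd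
  rw [← h2, ← h1, relIndex_order_eq_pow L v w hw he hτ j Λ O hΛ1 hO, relIndex_integer_traceDual_eq_pow L v w hw he hd Λ Λd hΛ1 hΛd,
    relIndex_integerTraceDual_orderTraceDual_eq_pow L v w hw he hτ j O Λd Od hO hΛd hOd]
  ring

include he in
/-- **HEAD — THE TRACE-DUAL INDEX OF THE CONDUCTOR ORDER `[O_j^# : O_j] = q_v^{d + 2j}`** (trace letters, `q_v = |𝓀(L⁺_v)|`): at a ramified CM place of ANY residue
characteristic, for `τ` a uniformiser of `L_w` with different number `d` (`|σ_w τ − τ| = exp(−d)`), the conductor-`j` order `O = 𝒪_v + ϖ_v^j 𝒪_w` (read σ-intrinsically as in ★ MARS ∕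
★ ADDITIVE MARS) and its dual `O♯ = {y : ∀ x ∈ O, |Tr_{L_w∕L⁺_v}(x·y)|_v ≤ 1}` for Mathlib's `Algebra.trace` (packet instance, ★ `QuadraticLocalTracePlace` §4) satisfy
**`O.relIndex O♯ = |𝓀(L⁺_v)| ^ (d + 2j)`** — equivalently `disc(O_j) = 𝔭_v^{d+2j}` (Gram determinant of `(1, ϖ_v^jτ)` is `ϖ_v^{2j}(u₀² + 4v₀)`).  `j = 0`: `[𝒪_w^# : 𝒪_w] = q^d = N(𝔇_{w∕v})`.
[cite: Serre1979, Ch. III §6 Cor. 2, Ch. III §3 Prop. 7] [cite: NeukirchANT1999, Ch. I §12, Ch. III §2 (2.4), (2.9)] [cite: CasselsFrohlichANT1967, Ch. VII §1.1] -/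
theorem relIndex_order_orderTraceDual_eq_pow {τ : w.1.adicCompletion L} (hτ : Valued.v τ = WithZero.exp (-1 : ℤ)) {d : ℕ}
    (hd : Valued.v (galAdicCompletionMap (L := L) (IsCMField.complexConj L) hw τ - τ) = WithZero.exp (-(d : ℤ))) (j : ℕ) (O Od : AddSubgroup (w.1.adicCompletion L))
    (hO : ∀ x, x ∈ O ↔ Valued.v x ≤ 1 ∧
      Valued.v (galAdicCompletionMap (L := L) (IsCMField.complexConj L) hw x - x) ≤ WithZero.exp (-(2 * j : ℤ)) * Valued.v (galAdicCompletionMap (L := L) (IsCMField.complexConj L) hw τ - τ))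
    (hOd : ∀ y, y ∈ Od ↔ ∀ x ∈ O, Valued.v (Algebra.trace (v.adicCompletion ↥(maximalRealSubfield L)) (((w : SemiLocal.Place ↥(maximalRealSubfield L) L v) : HeightOneSpectrum (𝓞 L)).adicCompletion L) (x * y)) ≤ 1) :
    O.relIndex Od = Nat.card 𝓀[v.adicCompletion ↥(maximalRealSubfield L)] ^ (d + 2 * j) := by
  rw [natCard_residueField_valuativeRel_eq]
  exact relIndex_order_orderTraceDual_eq_absNorm_pow L v w hw he hτ hd j O Od hO fun y =>
    (hOd y).trans (forall_mem_valued_trace_mul_le_one_iff L v w hw O y)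

include he in
/-- The HEAD in ABSOLUTE-NORM currency (trace letters): `O.relIndex O♯ = N(v) ^ (d + 2j)`. [cite: Serre1979, Ch. III §6 Cor. 2] [cite: NeukirchANT1999, Ch. III §2 (2.9)] -/
theorem relIndex_order_orderTraceDual_eq_absNorm_pow_of_trace {τ : w.1.adicCompletion L} (hτ : Valued.v τ = WithZero.exp (-1 : ℤ)) {d : ℕ}
    (hd : Valued.v (galAdicCompletionMap (L := L) (IsCMField.complexConj L) hw τ - τ) = WithZero.exp (-(d : ℤ))) (j : ℕ) (O Od : AddSubgroup (w.1.adicCompletion L))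
    (hO : ∀ x, x ∈ O ↔ Valued.v x ≤ 1 ∧
      Valued.v (galAdicCompletionMap (L := L) (IsCMField.complexConj L) hw x - x) ≤ WithZero.exp (-(2 * j : ℤ)) * Valued.v (galAdicCompletionMap (L := L) (IsCMField.complexConj L) hw τ - τ))
    (hOd : ∀ y, y ∈ Od ↔ ∀ x ∈ O, Valued.v (Algebra.trace (v.adicCompletion ↥(maximalRealSubfield L)) (((w : SemiLocal.Place ↥(maximalRealSubfield L) L v) : HeightOneSpectrum (𝓞 L)).adicCompletion L) (x * y)) ≤ 1) :
    O.relIndex Od = Nat.card (𝓞 ↥(maximalRealSubfield L) ⧸ v.asIdeal) ^ (d + 2 * j) :=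
  relIndex_order_orderTraceDual_eq_absNorm_pow L v w hw he hτ hd j O Od hO fun y =>
    (hOd y).trans (forall_mem_valued_trace_mul_le_one_iff L v w hw O y)

include he in
/-- **ONE PACKAGE** (existence form): for every `j` there are additive subgroups `O ≤ O♯` of `L_w` — the conductor-`j` order and its trace dual, characterised by membership in
trace letters — with `O.relIndex O♯ = |𝓀(L⁺_v)| ^ (d + 2j)`. [cite: Serre1979, Ch. III §6 Cor. 2] [cite: NeukirchANT1999, Ch. I §12] -/
theorem exists_addSubgroups_order_orderTraceDual_relIndex_eq_pow {τ : w.1.adicCompletion L} (hτ : Valued.v τ = WithZero.exp (-1 : ℤ)) {d : ℕ}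
    (hd : Valued.v (galAdicCompletionMap (L := L) (IsCMField.complexConj L) hw τ - τ) = WithZero.exp (-(d : ℤ))) (j : ℕ) :
    ∃ O Od : AddSubgroup (w.1.adicCompletion L),
      (∀ x, x ∈ O ↔ Valued.v x ≤ 1 ∧ Valued.v (galAdicCompletionMap (L := L) (IsCMField.complexConj L) hw x - x) ≤ WithZero.exp (-(2 * j : ℤ)) * Valued.v (galAdicCompletionMap (L := L) (IsCMField.complexConj L) hw τ - τ)) ∧
      (∀ y, y ∈ Od ↔ ∀ x ∈ O, Valued.v (Algebra.trace (v.adicCompletion ↥(maximalRealSubfield L)) (((w : SemiLocal.Place ↥(maximalRealSubfield L) L v) : HeightOneSpectrum (𝓞 L)).adicCompletion L) (x * y)) ≤ 1) ∧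
      O ≤ Od ∧ O.relIndex Od = Nat.card 𝓀[v.adicCompletion ↥(maximalRealSubfield L)] ^ (d + 2 * j) := by
  obtain ⟨O, hO⟩ := exists_addSubgroup_order L v w hw (WithZero.exp (-(2 * j : ℤ)) * Valued.v (galAdicCompletionMap (L := L) (IsCMField.complexConj L) hw τ - τ))
  obtain ⟨Od, hOd⟩ := exists_addSubgroup_traceDual_of_trace L v w hw O
  refine ⟨O, Od, hO, hOd, fun y hy => (hOd y).2 fun x hx => ?_, relIndex_order_orderTraceDual_eq_pow L v w hw he hτ hd j O Od hO hOd⟩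
  -- `O ≤ O♯`: products of integers are integers, and `|Tr z|_v ≤ 1` for `|z|_w ≤ 1`
  rw [valued_trace_le_one_iff_valued_add_galAdicCompletionMap L v w hw]
  have hxy : Valued.v (x * y) ≤ 1 := by
    rw [map_mul]
    calc Valued.v x * Valued.v y ≤ 1 * 1 := by gcongr; exacts [((hO x).1 hx).1, ((hO y).1 hy).1]
      _ = 1 := one_mul 1
  refine (Valued.v.map_add _ _).trans (max_le hxy ?_)
  rw [valued_galAdicCompletionMap]; exact hxy

/-- SANITY (`j = 0`): the HEAD at `j = 0` is `[𝒪_w^# : 𝒪_w] = q^d` — the exponent `d + 2·0 = d` of ★ `relIndex_integer_traceDual_eq_pow` (the order `O_0` is `𝒪_w` by ★ σ-DEPTH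
`valued_galAdicCompletionMap_sub_self_le_of_mem_integer'`). [cite: Serre1979, Ch. III §3 Prop. 7] -/
example {τ : w.1.adicCompletion L} (hτ : Valued.v τ = WithZero.exp (-1 : ℤ)) {d : ℕ} (he' : v.asIdeal.ramificationIdx' w.1.asIdeal ≠ 1)
    (hd : Valued.v (galAdicCompletionMap (L := L) (IsCMField.complexConj L) hw τ - τ) = WithZero.exp (-(d : ℤ))) (O Od : AddSubgroup (w.1.adicCompletion L))
    (hO : ∀ x, x ∈ O ↔ Valued.v x ≤ 1 ∧
      Valued.v (galAdicCompletionMap (L := L) (IsCMField.complexConj L) hw x - x) ≤ WithZero.exp (-(2 * (0 : ℕ) : ℤ)) * Valued.v (galAdicCompletionMap (L := L) (IsCMField.complexConj L) hw τ - τ))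
    (hOd : ∀ y, y ∈ Od ↔ ∀ x ∈ O, Valued.v (Algebra.trace (v.adicCompletion ↥(maximalRealSubfield L)) (((w : SemiLocal.Place ↥(maximalRealSubfield L) L v) : HeightOneSpectrum (𝓞 L)).adicCompletion L) (x * y)) ≤ 1) :
    O.relIndex Od = Nat.card 𝓀[v.adicCompletion ↥(maximalRealSubfield L)] ^ d := by
  simpa using relIndex_order_orderTraceDual_eq_pow L v w hw he' hτ hd 0 O Od hO hOd

end Literature.NumberTheory.Automorphic.UnitaryGroup

end
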